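import Mathlib
import Literature.NumberTheory.LFunctions.DedekindZeta
import HarnessLib

/-!
# ArtinPrimitiveRootProgressions

Topic `Literature/NumberTheory/Multiplicative`. Named literature fact(s) relocated by the gate from `Summits/BirchSwinnertonDyer/BirchSwinnertonDyer/Theorems/ResidualThetaTransportAtTwoThetaLayerLambdaCongruenceAtTwoCuspSpanArtinERH.lean`
(accept-time relocation of `[cite]`d propositions written inline in a Summits proposal; human ruling 2026-08-15).
Sources: Lenstra1977, Moree1999.

* `Literature.NumberTheory.Multiplicative.lenstra1977_exists_prime_two_primitiveRoot_progression_of_ERH`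
-/

namespace Literature.NumberTheory.Multiplicative

open scoped MatrixGroups
open CongruenceSubgroup

/-- **Hooley–Lenstra–Moree: Artin primes for the base `2` in progressions `≡ 3 (mod 8)`, under GRH.** Assuming the Riemann Hypothesis
for the Dedekind zeta functions of the number fields `ℚ(ζ_M, ζ_n, 2^{1/n})` — implied by ERH for every number field, the tree's
`Literature.NumberTheory.LFunctions.ExtendedRiemannHypothesis` —, for every modulus `M` with `8 ∣ M` and every `r ≡ 3 (mod 8)` prime to
`M` the primes `q ≡ r (mod M)` of which `2` is a primitive root have natural density `δ(r, M, 2) = 2·A(r, M, 1)/φ(M) > 0`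
(Moree 1999 Thm. 2 with `g = 2`, `h = 1`, `Δ = 8`; Lenstra 1977 Thm. (8.3); Thm. 4: `δ = 0` iff `8 ∣ M` and `(2/r) = +1`); in particular
there are arbitrarily large such primes. «`2` is a primitive root mod `q`» is spelled `orderOf (2 : ZMod q) = q − 1`.
[cite: Moree1999, Thm. 2 and Thm. 4 (pp. 86–87, 91)] [cite: Lenstra1977, Thm. (8.3)] [file NumberTheory/Multiplicative/ArtinPrimitiveRootProgressions] -/
def lenstra1977_exists_prime_two_primitiveRoot_progression_of_ERH : Prop :=
  Literature.NumberTheory.LFunctions.ExtendedRiemannHypothesis →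
    ∀ (M r B : ℕ), 8 ∣ M → r % 8 = 3 → Nat.Coprime r M →
      ∃ q : ℕ, q.Prime ∧ B < q ∧ q ≡ r [MOD M] ∧ orderOf (2 : ZMod q) = q - 1

end Literature.NumberTheory.Multiplicative
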